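import Summits.QuantumFields.BalabanUV.T4Continuum.Support.DirichletTubeHoleFilling
import Summits.QuantumFields.BalabanUV.T4Continuum.Support.DirichletMorreyDecay

/-!
# `BalabanUV.T4Continuum.Support.DirichletTubeDecay` — NE2 (node U1a) formalisation swarm, sub-row `T4-U1a.S-NE2-D1-DIRICHLET°`, supplier item
# «Δ1-HOLEFILL» (tube decay, part 4): MORREY DECAY TOWARDS A LINE — the tube step iterated over dyadic TRANSVERSAL scales with a fixed
# longitudinal profile: the weighted transversal energy near the line decays like `θ_d^J`, the ramps of the profile feeding a geometric source
# (unit b2b-balaban-t4-ne2-formalise-leaf-08, gen 6, file 14)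

HONEST FRAMING.  Rung (B)+1 bookkeeping at MODEL level (one lattice field, finite torus); [folklore] lattice De Giorgi–Widman; NE2 (U1a) is
NOT proved by this file; spine PROVED 0/9 unchanged; NOT infinite volume, NOT the mass gap, NOT Clay.  HONEST DEPENDENCY (verbatim):
«continuum YM on T⁴ ⇐ BetaPertH ∧ nine spine estimates (0/9 proved); BetaPertH ⇐ (D1) ∧ (D4) ∧ CAP+tail; G-an2-4 gates asym, D1 and NE2/3/4.»

WHAT THIS FILE PROVES (0 sorry).  Notation of `DirichletTubeHoleFilling` (torus `Tor N`, `N : Fin (d+1) → ℕ`, `d ≥ 2` transversal directions, one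
longitudinal direction `μ₀`, profile `φ ≥ 0` with `|φ(t+1) − φ t| ≤ ℓ` and zone `S`, transversal charts on `Tor N′`):
**`tube_decay`**: for every `J`, with `K = 2^J m`, `4K = n + 1 ≤ N′ ν`, transversal base `b′`, and all slices `zsl t`, `t ∈ S`, vanishing on the
chart octant `oct σ K`,
`Σ_t φ(t)²·dirOn univ (zsl t ∘ chart (shift (2K − 2m) b′)) ≤ θ_d^J·(Σ_t φ(t)²·dirOn univ (zsl t ∘ chart b′)
   + 64(1+2^d)K²·(Σ_t φ(t)²Σ_j‖(1_ΩΔz)(ins t (chart b′ j))‖²/‖c‖⁴ + 4ℓ²·Σ_{t∈S} dirOn univ (zsl t ∘ chart b′)))` —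
induction on `J` over `tube_step`, per-slice re-centring `DirichletMorreyDecay.dirOn_shift` ∕ `sum_shift_le` ∕ `emb_mem_oct`; the two `K²`-weighted
terms are geometric sources absorbed because `θ_d ≥ ½`.  Reading: the transversal energy of `z` within `2m` sites of the line `{x′ = centre}` on the
plateau of `φ` is at most `(m/K)^{2s_d}` of the budget — TUBE DECAY for line-type conflict loci (memo `t4/T4-EST-NE2-D1-HOLEFILL.md` §4).

ABSOLUTE RULE (cell, verbatim): «No internally-minted statement may enter as a cited fact. Every hypothesis is either kernel-proved in
this package or a verbatim quotation of a PUBLISHED theorem with page reference. The manuscript(s) under audit are NOT citable for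
their own disputed steps — they are the thing under adjudication; programme-internal (2001/route/tribunal) claims are never citable.»
[folklore]; no definitions; no `def … : Prop` fact.  NOT CLAIMED: the residue assembly H-E/H-F; the construction of `φ` from a lattice ramp and
the block-region instance (a junction file); NE2; NE3.
-/

noncomputable section

open scoped BigOperators ComplexConjugate Matrix
open Finset

namespace Summit.QuantumFields.BalabanUV.T4Continuum.DirichletTubeDecay

open Literature.MathematicalPhysics.QuantumFieldTheory.Balaban1983to89.B5Prop11Plancherel (Tor unitVec)
open Literature.MathematicalPhysics.QuantumFieldTheory.Balaban1983to89.B5Action121 (LapS)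
open Summit.QuantumFields.BalabanUV.T4Continuum.DirichletDirectionalBesov (restrictTo)
open Summit.QuantumFields.BalabanUV.T4Continuum.CoordSlabPoincare (dirOn dirOn_nonneg)
open Summit.QuantumFields.BalabanUV.T4Continuum.CoordOctantBoxes (oct)
open Summit.QuantumFields.BalabanUV.T4Continuum.CoordAnnulusPoincare (inner slabDir_nonneg slabs_dir_le)
open Summit.QuantumFields.BalabanUV.T4Continuum.DirichletHoleFillingCutoff (chart)
open Summit.QuantumFields.BalabanUV.T4Continuum.DirichletHoleFilling (theta theta_lt_one)
open Summit.QuantumFields.BalabanUV.T4Continuum.DirichletMorreyDecay (shift shift_shift shift_zero emb chart_emb dirOn_shift sum_shift_le emb_mem_oct)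
open Summit.QuantumFields.BalabanUV.T4Continuum.TorusSlicing (Nsl ins zsl)
open Summit.QuantumFields.BalabanUV.T4Continuum.DirichletTubeHoleFilling (tube_step)

variable {d : ℕ} (N : Fin (d + 1) → ℕ) [hN : ∀ μ, NeZero (N μ)] (μ₀ : Fin (d + 1)) (φ : ZMod (N μ₀) → ℝ) (c : ℂ)
  {Ω : Tor N → Prop} [DecidablePred Ω] (z : Tor N → ℂ) (σ : Fin d → Bool)

/-- **MORREY DECAY TOWARDS A LINE (tube decay).**  See the module docstring. [folklore] -/
theorem tube_decay (hd : 2 ≤ d) (hc : c ≠ 0) (hz : ∀ x, ¬ Ω x → z x = 0) (hφ0 : ∀ t, 0 ≤ φ t) {ℓ : ℝ}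
    (hφL : ∀ t, |φ (t + 1) - φ t| ≤ ℓ) (S : Finset (ZMod (N μ₀))) (hS1 : ∀ t, φ t ≠ 0 → t ∈ S)
    (hS2 : ∀ t, φ (t + 1) ≠ φ t → t ∈ S ∧ t + 1 ∈ S) {m : ℕ} (hm : 1 ≤ m) {n₀ : ℕ} (hn₀ : 4 * m = n₀ + 1) :
    ∀ (J : ℕ) {n : ℕ} (hn : 4 * (2 ^ J * m) = n + 1) (hN' : ∀ ν, n + 1 ≤ Nsl N μ₀ ν) (b' : Tor (Nsl N μ₀))
      (hvan : ∀ t ∈ S, ∀ j ∈ oct (n := n) (2 ^ J * m) σ, zsl N μ₀ z t (chart (Nsl N μ₀) b' j) = 0),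
      ∑ t : ZMod (N μ₀), φ t ^ 2 * dirOn (univ : Finset (Fin d → Fin (n₀ + 1)))
          (zsl N μ₀ z t ∘ chart (Nsl N μ₀) (n := n₀) (shift (Nsl N μ₀) (2 * 2 ^ J * m - 2 * m) b'))
        ≤ theta d ^ J * (∑ t : ZMod (N μ₀), φ t ^ 2 * dirOn (univ : Finset (Fin d → Fin (n + 1))) (zsl N μ₀ z t ∘ chart (Nsl N μ₀) (n := n) b')
            + 64 * (1 + 2 ^ d) * ((2 ^ J * m : ℕ) : ℝ) ^ 2 *
              ((∑ t : ZMod (N μ₀), φ t ^ 2 * ∑ j : Fin d → Fin (n + 1),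
                  ‖restrictTo Ω (LapS N c *ᵥ z) (ins N μ₀ t (chart (Nsl N μ₀) b' j))‖ ^ 2) / ‖c‖ ^ 4
                + 4 * ℓ ^ 2 * ∑ t ∈ S, dirOn (univ : Finset (Fin d → Fin (n + 1))) (zsl N μ₀ z t ∘ chart (Nsl N μ₀) (n := n) b'))) := by
  intro J
  induction J with
  | zero =>
    intro n hn hN' b' hvan
    have hnn : n₀ = n := by rw [pow_zero, one_mul] at hn; omega
    subst hnn
    rw [show 2 * 2 ^ 0 * m - 2 * m = 0 by simp, shift_zero, pow_zero (theta d), one_mul]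
    refine le_add_of_nonneg_right (mul_nonneg (by positivity) (add_nonneg (div_nonneg ?_ (by positivity)) ?_))
    · exact Finset.sum_nonneg fun t _ => mul_nonneg (sq_nonneg _) (Finset.sum_nonneg fun _ _ => sq_nonneg _)
    · exact mul_nonneg (by positivity) (Finset.sum_nonneg fun t _ => dirOn_nonneg _ _)
  | succ J ih =>
    intro n hn hN' b' hvan
    set K := 2 ^ (J + 1) * m with hK
    set K' := 2 ^ J * m with hK'
    have hKK : K = 2 * K' := by rw [hK, hK', pow_succ]; ring
    have hK'pos : 1 ≤ K' := by rw [hK']; exact Nat.one_le_iff_ne_zero.mpr (by positivity)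
    have hK2 : 2 ≤ K := by omega
    obtain ⟨n', hn'⟩ : ∃ n', 2 * K = n' + 1 := ⟨2 * K - 1, by omega⟩
    have hn'K : 4 * (2 ^ J * m) = n' + 1 := by rw [← hK']; omega
    have hN'' : ∀ ν, n' + 1 ≤ Nsl N μ₀ ν := fun ν => by have := hN' ν; omega
    -- one tube step at the big transversal scale
    have hstep := tube_step N μ₀ K b' φ c z σ hd hK2 hn hN' hc hz hφ0 hφL S hS1 hS2 hvan
    -- per-slice re-centring, inherited vanishing, shrinking sources
    have hdir : ∀ t, dirOn (univ : Finset (Fin d → Fin (n' + 1))) (zsl N μ₀ z t ∘ chart (Nsl N μ₀) (n := n') (shift (Nsl N μ₀) K b'))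
        = dirOn (inner (n := n) K) (zsl N μ₀ z t ∘ chart (Nsl N μ₀) (n := n) b') := fun t => dirOn_shift (Nsl N μ₀) K hn hn' b' _
    have hvan' : ∀ t ∈ S, ∀ j' ∈ oct (n := n') (2 ^ J * m) σ, zsl N μ₀ z t (chart (Nsl N μ₀) (shift (Nsl N μ₀) K b') j') = 0 := by
      intro t ht j' hj'
      rw [← chart_emb (Nsl N μ₀) K hn hn']
      exact hvan t ht _ (emb_mem_oct K hn hn' (k' := 2 ^ J * m) (by rw [← hK']; omega) σ hj')
    have hih := ih hn'K hN'' (shift (Nsl N μ₀) K b') hvan'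
    rw [shift_shift] at hih
    have hshift : K + (2 * 2 ^ J * m - 2 * m) = 2 * 2 ^ (J + 1) * m - 2 * m := by
      have hP1 : 2 * 2 ^ J * m = 2 * K' := by rw [hK']; ring
      have hP2 : 2 * 2 ^ (J + 1) * m = 4 * K' := by rw [hK', pow_succ]; ring
      have hmK : m ≤ K' := by rw [hK']; exact Nat.le_mul_of_pos_left m (by positivity)
      rw [hP1, hP2, hKK]; omega
    rw [hshift] at hih
    have hsrc : ∀ t, ∑ j' : Fin d → Fin (n' + 1), ‖restrictTo Ω (LapS N c *ᵥ z) (ins N μ₀ t (chart (Nsl N μ₀) (shift (Nsl N μ₀) K b') j'))‖ ^ 2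
        ≤ ∑ j : Fin d → Fin (n + 1), ‖restrictTo Ω (LapS N c *ᵥ z) (ins N μ₀ t (chart (Nsl N μ₀) b' j))‖ ^ 2 :=
      fun t => sum_shift_le (Nsl N μ₀) K hn hn' b' (G := fun y => ‖restrictTo Ω (LapS N c *ᵥ z) (ins N μ₀ t y)‖ ^ 2) (fun _ => sq_nonneg _)
    have hDIJ : ∀ t, dirOn (inner (n := n) K) (zsl N μ₀ z t ∘ chart (Nsl N μ₀) (n := n) b')
        ≤ dirOn univ (zsl N μ₀ z t ∘ chart (Nsl N μ₀) (n := n) b') := fun t => by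
      have h := slabs_dir_le K hn (zsl N μ₀ z t ∘ chart (Nsl N μ₀) (n := n) b')
      have h0 := slabDir_nonneg (n := n) K (zsl N μ₀ z t ∘ chart (Nsl N μ₀) (n := n) b')
      have hd1 : (1 : ℝ) ≤ d := by exact_mod_cast (show 1 ≤ d by omega)
      nlinarith
    -- abbreviations
    set a := ∑ t : ZMod (N μ₀), φ t ^ 2 * dirOn (univ : Finset (Fin d → Fin (n + 1))) (zsl N μ₀ z t ∘ chart (Nsl N μ₀) (n := n) b') with ha
    set Mw := ∑ t : ZMod (N μ₀), φ t ^ 2 * ∑ j : Fin d → Fin (n + 1),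
        ‖restrictTo Ω (LapS N c *ᵥ z) (ins N μ₀ t (chart (Nsl N μ₀) b' j))‖ ^ 2 with hMw
    set U := ∑ t ∈ S, dirOn (univ : Finset (Fin d → Fin (n + 1))) (zsl N μ₀ z t ∘ chart (Nsl N μ₀) (n := n) b') with hU
    set a' := ∑ t : ZMod (N μ₀), φ t ^ 2 * dirOn (univ : Finset (Fin d → Fin (n' + 1)))
        (zsl N μ₀ z t ∘ chart (Nsl N μ₀) (n := n') (shift (Nsl N μ₀) K b')) with ha'
    set Mw' := ∑ t : ZMod (N μ₀), φ t ^ 2 * ∑ j' : Fin d → Fin (n' + 1),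
        ‖restrictTo Ω (LapS N c *ᵥ z) (ins N μ₀ t (chart (Nsl N μ₀) (shift (Nsl N μ₀) K b') j'))‖ ^ 2 with hMw'
    set U' := ∑ t ∈ S, dirOn (univ : Finset (Fin d → Fin (n' + 1))) (zsl N μ₀ z t ∘ chart (Nsl N μ₀) (n := n') (shift (Nsl N μ₀) K b')) with hU'
    have hθ := theta_lt_one d
    have hθ0 : 0 ≤ theta d := by linarith [hθ.1]
    have hθJ : 0 ≤ theta d ^ J := pow_nonneg hθ0 J
    have hcpos : 0 < ‖c‖ := norm_pos_iff.mpr hc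
    have hMw0 : 0 ≤ Mw := Finset.sum_nonneg fun t _ => mul_nonneg (sq_nonneg _) (Finset.sum_nonneg fun _ _ => sq_nonneg _)
    have hU0 : 0 ≤ U := Finset.sum_nonneg fun t _ => dirOn_nonneg _ _
    have hMw'le : Mw' ≤ Mw := Finset.sum_le_sum fun t _ => mul_le_mul_of_nonneg_left (hsrc t) (sq_nonneg _)
    have hU'le : U' ≤ U := Finset.sum_le_sum fun t _ => by rw [hdir t]; exact hDIJ t
    have ha'eq : a' = ∑ t : ZMod (N μ₀), φ t ^ 2 * dirOn (inner (n := n) K) (zsl N μ₀ z t ∘ chart (Nsl N μ₀) (n := n) b') :=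
      Finset.sum_congr rfl fun t _ => by rw [hdir t]
    have hKr : ((K : ℕ) : ℝ) = 2 * ((K' : ℕ) : ℝ) := by rw [hKK]; push_cast; ring
    set B := Mw / ‖c‖ ^ 4 + 4 * ℓ ^ 2 * U with hB
    set B' := Mw' / ‖c‖ ^ 4 + 4 * ℓ ^ 2 * U' with hB'
    have hB0 : 0 ≤ B := add_nonneg (div_nonneg hMw0 (by positivity)) (mul_nonneg (by positivity) hU0)
    have hB'le : B' ≤ B := add_le_add (div_le_div_of_nonneg_right hMw'le (by positivity)) (mul_le_mul_of_nonneg_left hU'le (by positivity))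
    have hstep' : a' ≤ theta d * a + 16 * (1 + 2 ^ d) * ((K : ℕ) : ℝ) ^ 2 * B := by rw [ha'eq]; exact hstep
    have hcoef : 0 ≤ 64 * (1 + 2 ^ d) * ((K' : ℕ) : ℝ) ^ 2 := by positivity
    calc ∑ t : ZMod (N μ₀), φ t ^ 2 * dirOn univ (zsl N μ₀ z t ∘ chart (Nsl N μ₀) (shift (Nsl N μ₀) (2 * 2 ^ (J + 1) * m - 2 * m) b'))
        ≤ theta d ^ J * (a' + 64 * (1 + 2 ^ d) * ((K' : ℕ) : ℝ) ^ 2 * B') := hih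
      _ ≤ theta d ^ J * ((theta d * a + 16 * (1 + 2 ^ d) * ((K : ℕ) : ℝ) ^ 2 * B) + 64 * (1 + 2 ^ d) * ((K' : ℕ) : ℝ) ^ 2 * B) :=
          mul_le_mul_of_nonneg_left (add_le_add hstep' (mul_le_mul_of_nonneg_left hB'le hcoef)) hθJ
      _ ≤ theta d ^ (J + 1) * (a + 64 * (1 + 2 ^ d) * ((K : ℕ) : ℝ) ^ 2 * B) := by
          rw [pow_succ (theta d) J]
          have hkey : 16 * (1 + 2 ^ d) * ((K : ℕ) : ℝ) ^ 2 * B + 64 * (1 + 2 ^ d) * ((K' : ℕ) : ℝ) ^ 2 * B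
              ≤ theta d * (64 * (1 + 2 ^ d) * ((K : ℕ) : ℝ) ^ 2 * B) := by
            rw [hKr]
            have hM1 : 0 ≤ (1 + 2 ^ d) * ((K' : ℕ) : ℝ) ^ 2 * B := mul_nonneg (by positivity) hB0
            have e1 : 16 * (1 + 2 ^ d) * (2 * ((K' : ℕ) : ℝ)) ^ 2 * B + 64 * (1 + 2 ^ d) * ((K' : ℕ) : ℝ) ^ 2 * B
                = 128 * ((1 + 2 ^ d) * ((K' : ℕ) : ℝ) ^ 2 * B) := by ring
            have e2 : theta d * (64 * (1 + 2 ^ d) * (2 * ((K' : ℕ) : ℝ)) ^ 2 * B)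
                = (256 * theta d) * ((1 + 2 ^ d) * ((K' : ℕ) : ℝ) ^ 2 * B) := by ring
            rw [e1, e2]
            exact mul_le_mul_of_nonneg_right (by linarith [hθ.1]) hM1
          have h := mul_le_mul_of_nonneg_left hkey hθJ
          nlinarith [h]

end Summit.QuantumFields.BalabanUV.T4Continuum.DirichletTubeDecay

end
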